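import Mathlib
import HarnessLib
import Summits.NavierStokesRegularity.NavierStokesRegularity.Theses.LocalLambTubeDoor
import Summits.NavierStokesRegularity.NavierStokesRegularity.Theorems.LocalLambTubeDoorBeltramiProfileRigidity

/-!
# Route `LocalLambTubeDoor` (S12, rung N0-LocalTubeDoorLamb) — crux K2 `BeltramiWindowRigidity` is a THEOREM

Cell ns-regularity-ideate, seat p6 (birth filing; the route was opened from the staged package
HOME/ns-regularity-ideate-p6/route-lamb/).  The crux says: a profile of the Type-I class (rate, continuity, unit-viscosity
Oseen–Duhamel identity, divergence-free) has (i) continuous vorticity slices and (ii) is not backward-singular at the apex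
if every slice carries a nonempty open set on which the Lamb vector `v(s,·) × curl v(s,·)` vanishes.  (i): slices are
real-analytic (`analyticOnNhd_slice`), hence so is their curl (`analyticOnNhd_curl`); (ii): window ⇒ slab by slice
analyticity (`lambWindowToSlab`) and the Beltrami profile theorem `not_backwardSingular_of_beltrami` (p455778: the vorticity
of a Beltrami Type-I profile is a bounded ancient caloric field, hence constant, hence zero).  Closing item stmt-NavierStokesRegularity-19814.

WHAT THIS IS NOT: not a claim about Navier–Stokes regularity (Clay A).  The leaf is a regularity CRITERION (local Type I
+ L¹-fading of the scale-normalised Lamb vector (T−t)^{3/2}·u × curl u on ONE similarity window ⇒ backward bounded), one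
rung of LADDER-NS N0 (N0-LocalTubeDoorLamb); establishment in the cell's sense still requires the cross-family referee
PASS + independent reproduction.
-/

noncomputable section

-- the summit and its single sub-problem share the name (CONVENTIONS §1), as in every Theorems file
set_option linter.dupNamespace false

namespace Summit.NavierStokesRegularity.NavierStokesRegularity.Theorems.LocalLambTubeDoorBeltramiWindowRigidityClose

open Set Literature.Analysis Literature.Analysis.FluidPDE
open Summit.NavierStokesRegularity.NavierStokesRegularity.Theorems.LocalSineTubeDoorProfileAlignedWindowRigidityAncient
open Summit.NavierStokesRegularity.NavierStokesRegularity.Theorems.LocalLambTubeDoorBeltramiProfileRigidity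

/-- **Crux K2 `BeltramiWindowRigidity` (item stmt-NavierStokesRegularity-19814) is a THEOREM**: continuity of the vorticity slices from
slice analyticity, rigidity from `not_backwardSingular_of_beltrami ∘ lambWindowToSlab` (p455778). -/
theorem beltramiWindowRigidity_proof :
    Summit.NavierStokesRegularity.NavierStokesRegularity.Theses.LocalLambTubeDoor.BeltramiWindowRigidity := by
  intro C v hr hc hm hd
  refine ⟨fun s hs => ?_, fun hwin => not_backwardSingular_of_beltrami hr hc hm hd (lambWindowToSlab hr hc hm hwin)⟩
  rw [← continuousOn_univ]
  exact (analyticOnNhd_curl (analyticOnNhd_slice hc (bdd_of_hasTypeITimeDecay hr) hm hs)).continuousOn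

end Summit.NavierStokesRegularity.NavierStokesRegularity.Theorems.LocalLambTubeDoorBeltramiWindowRigidityClose

end
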